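import Literature.Analysis.FluidPDE.SawtoothCascadeK2Classical

/-!
# Consumer API of the classical K2″ receptacle: earlier phases and the uniform window envelope
(route `AnomalousDissipation/SawtoothPulseCascade`, crux `K2LinearisedCascadeGrowth`,
stmt-AnomalousDissipation-20025; helper for its consumer ApproxSol58 of K3loc)

`Literature.Analysis.FluidPDE.SawtoothCascade.K2PhaseGrowthClassical P C` bounds a classical linearised
response `(w, q)` defined on the window `[tInject j₀ hz, tStart (J+1)]` only on its LAST phase
`[max (tInject j₀ hz) (tStart J), tStart (J+1)]`; its docstring says "earlier phases `j₀ ≤ J' < J` are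
covered by instantiating `J'`".  Instantiating `J'` needs the solution RESTRICTED to the shorter window
`[tInject j₀ hz, tStart (J'+1)]` — joint smoothness restricts (`IsSmoothSpaceTimeOn.mono`) and the one-sided
time derivative within the shorter (non-degenerate) interval agrees with the one within the longer.  This
file does that bookkeeping once, for every consumer:

* `exists_phase_of_mem_window`: every `t` of the window lies in some phase `J' ∈ [j₀, J]`,
  `t ∈ [max (tInject j₀ hz) (tStart J'), tStart (J'+1)]` (`Nat.findGreatest`);
* `k2PhaseGrowthClassical_apply_of_le`: from `K2PhaseGrowthClassical P C`, the phase-`J'` bound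
  `‖w(t)‖² ≤ (C e^{σ⋆γ})^{2(J'+1−j₀)} ‖w₀‖²` for a solution given on the longer `J`-window, `j₀ ≤ J' ≤ J`;
* `k2PhaseGrowthClassical_uniform`: when `C e^{σ⋆γ} ≥ 1` (e.g. the route's `C = 3`), the envelope
  `‖w(t)‖² ≤ (C e^{σ⋆γ})^{2(J+1−j₀)} ‖w₀‖²` holds for EVERY `t` in the window `[tInject j₀ hz, tStart (J+1)]`.
-/

-- `Summit.<Summit>.<Problem>` is the tree's mandated summit-side namespace (CONVENTIONS §2); for this
-- single-conjunct summit the two coincide, so the duplicate is deliberate (lakefile: off for `Summits`).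
set_option linter.dupNamespace false

noncomputable section

namespace Summit.AnomalousDissipation.AnomalousDissipation.Theorems.SawtoothPulseCascade.K2Classical

open Set MeasureTheory
open Literature.Analysis Literature.Analysis.FunctionSpaces Literature.Analysis.FluidPDE
open Literature.Analysis.FluidPDE.SawtoothCascade
open Literature.Analysis.FluidPDE.SawtoothCascade.CascadeParams

/-- The one-sided time derivative within a non-degenerate sub-interval `[a', b'] ⊆ [a, b]` of a field
jointly smooth on `[a, b]` agrees with the one within `[a, b]` (Mathlib `HasDerivWithinAt.mono`,
`HasDerivWithinAt.derivWithin`, `uniqueDiffOn_Icc`). -/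
private theorem timeDerivWithin_Icc_eq_of_subset' {a b a' b' : ℝ} (hlt : a' < b')
    (hsub : Icc a' b' ⊆ Icc a b) {w : ℝ → UnitAddTorus (Fin 2) → EuclideanSpace ℝ (Fin 2)}
    (hw : Torus.IsSmoothSpaceTimeOn (Icc a b) w) {t : ℝ} (ht : t ∈ Icc a' b')
    (x : UnitAddTorus (Fin 2)) :
    Torus.timeDerivWithin (Icc a' b') w t x = Torus.timeDerivWithin (Icc a b) w t x :=
  ((hw.hasDerivWithinAt_slice (hsub ht) x).mono hsub).derivWithin (uniqueDiffOn_Icc hlt t ht)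

/-- `tStart j₀ ≤ tInject j₀ hz ≤ tStart j₀ + tHalf j₀`: the injection time lies in the H half-slot of
its phase (closed). -/
theorem tInject_mem_Icc (j₀ : ℕ) (hz : Bool) :
    CascadeParams.tInject j₀ hz ∈ Icc (tStart j₀) (tStart j₀ + tHalf j₀) := by
  unfold CascadeParams.tInject
  cases hz
  · simp only [Bool.false_eq_true, ↓reduceIte]
    exact ⟨by linarith [tHalf_pos j₀], le_rfl⟩
  · simp only [↓reduceIte]
    exact ⟨le_rfl, by linarith [tHalf_pos j₀]⟩

/-- `tInject j₀ hz < tStart (j₀ + 1)`: the injection happens strictly before the end of its phase. -/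
theorem tInject_lt_tStart_succ (j₀ : ℕ) (hz : Bool) :
    CascadeParams.tInject j₀ hz < tStart (j₀ + 1) := by
  have h := (tInject_mem_Icc j₀ hz).2
  rw [tStart_succ]
  linarith [tHalf_pos j₀]

/-- **Phase location.** Every time `t` of the K2″ window `[tInject j₀ hz, tStart (J+1)]` (`j₀ ≤ J`) lies
in some phase `J'` with `j₀ ≤ J' ≤ J`: `t ∈ [max (tInject j₀ hz) (tStart J'), tStart (J'+1)]`
(`J'` = the largest `i ≤ J` with `tStart i ≤ t`). -/
theorem exists_phase_of_mem_window {j₀ J : ℕ} (hj : j₀ ≤ J) (hz : Bool) {t : ℝ}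
    (ht : t ∈ Icc (CascadeParams.tInject j₀ hz) (tStart (J + 1))) :
    ∃ J', j₀ ≤ J' ∧ J' ≤ J ∧
      t ∈ Icc (max (CascadeParams.tInject j₀ hz) (tStart J')) (tStart (J' + 1)) := by
  classical
  have h0 : tStart j₀ ≤ t := (tInject_mem_Icc j₀ hz).1.trans ht.1
  refine ⟨Nat.findGreatest (fun i => tStart i ≤ t) J, Nat.le_findGreatest hj h0,
    Nat.findGreatest_le J, ⟨max_le ht.1 (Nat.findGreatest_spec (P := fun i => tStart i ≤ t) hj h0), ?_⟩⟩
  rcases (Nat.findGreatest_le (P := fun i => tStart i ≤ t) J).lt_or_eq with hlt | heq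
  · by_contra hcon
    exact Nat.findGreatest_is_greatest (P := fun i => tStart i ≤ t) (Nat.lt_succ_self _)
      (Nat.succ_le_of_lt hlt) (le_of_not_ge hcon)
  · rw [heq]
    exact ht.2

/-- **Earlier phases from the classical K2″ receptacle.** If `K2PhaseGrowthClassical P C` holds, then for a
classical linearised response `(w, q)` given on the window `[tInject j₀ hz, tStart (J+1)]` and every
intermediate phase `J'`, `j₀ ≤ J' ≤ J`, the phase-`J'` bound
`‖w(t)‖²_{L²} ≤ (C e^{σ⋆γ})^{2(J'+1−j₀)} ‖w₀‖²_{L²}` holds on `[max (tInject j₀ hz) (tStart J'), tStart (J'+1)]`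
(restrict the solution to the `J'`-window and instantiate the receptacle at `J'`; same threshold `ν₀`). -/
theorem k2PhaseGrowthClassical_apply_of_le {P : CascadeParams} {C : ℝ}
    (h : K2PhaseGrowthClassical P C) :
    ∃ ν₀ : ℝ, 0 < ν₀ ∧ ∀ ν ∈ Ioc 0 ν₀, ∀ (j₀ J' J : ℕ), j₀ ≤ J' → J' ≤ J → ∀ (hz : Bool)
      (w₀ : UnitAddTorus (Fin 2) → EuclideanSpace ℝ (Fin 2))
      (w : ℝ → UnitAddTorus (Fin 2) → EuclideanSpace ℝ (Fin 2)) (q : ℝ → UnitAddTorus (Fin 2) → ℝ),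
      ShearCombDatum (P.N j₀) hz w₀ →
      Torus.IsSmoothSpaceTimeOn (Icc (CascadeParams.tInject j₀ hz) (CascadeParams.tStart (J + 1))) w →
      Torus.IsSmoothSpaceTimeOn (Icc (CascadeParams.tInject j₀ hz) (CascadeParams.tStart (J + 1))) q →
      (∀ t ∈ Icc (CascadeParams.tInject j₀ hz) (CascadeParams.tStart (J + 1)), Torus.IsDivFree (w t)) →
      (∀ t ∈ Icc (CascadeParams.tInject j₀ hz) (CascadeParams.tStart (J + 1)), ∀ x,
        Torus.timeDerivWithin (Icc (CascadeParams.tInject j₀ hz) (CascadeParams.tStart (J + 1))) w t x +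
          Torus.convect (P.field t) (w t) x + Torus.convect (w t) (P.field t) x =
          ν • Torus.laplacian (w t) x - Torus.gradient (q t) x) →
      w (CascadeParams.tInject j₀ hz) = w₀ →
      ∀ t ∈ Icc (max (CascadeParams.tInject j₀ hz) (CascadeParams.tStart J'))
          (CascadeParams.tStart (J' + 1)),
        Torus.vectorL2Sq (w t) ≤
          (C * Real.exp (sawSigmaStar * P.γ)) ^ (2 * (J' + 1 - j₀)) * Torus.vectorL2Sq w₀ := by
  obtain ⟨ν₀, hν₀, H⟩ := h
  refine ⟨ν₀, hν₀, fun ν hν j₀ J' J hj hJ hz w₀ w q hd hw hq hdiv heq h0 t ht => ?_⟩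
  have hsub : Icc (CascadeParams.tInject j₀ hz) (tStart (J' + 1)) ⊆
      Icc (CascadeParams.tInject j₀ hz) (tStart (J + 1)) :=
    Icc_subset_Icc le_rfl (tStart_strictMono.monotone (by omega))
  have hlt : CascadeParams.tInject j₀ hz < tStart (J' + 1) :=
    lt_of_lt_of_le (tInject_lt_tStart_succ j₀ hz) (tStart_strictMono.monotone (by omega))
  exact H ν hν j₀ J' hj hz w₀ w q hd (hw.mono hsub) (hq.mono hsub) (fun s hs => hdiv s (hsub hs))
    (fun s hs x => by
      rw [timeDerivWithin_Icc_eq_of_subset' hlt hsub hw hs x]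
      exact heq s (hsub hs) x) h0 t ht

/-- **Uniform window envelope from the classical K2″ receptacle.** If `K2PhaseGrowthClassical P C` holds
and `C e^{σ⋆γ} ≥ 1` (e.g. the route's `C = 3`), then for every classical linearised response on
`[tInject j₀ hz, tStart (J+1)]` the LAST-phase constant bounds the WHOLE window:
`‖w(t)‖²_{L²} ≤ (C e^{σ⋆γ})^{2(J+1−j₀)} ‖w₀‖²_{L²}` for all `t ∈ [tInject j₀ hz, tStart (J+1)]`
(phase location + `k2PhaseGrowthClassical_apply_of_le` + monotonicity of `k ↦ (C e^{σ⋆γ})^{2k}`). -/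
theorem k2PhaseGrowthClassical_uniform {P : CascadeParams} {C : ℝ} (h : K2PhaseGrowthClassical P C)
    (hC : 1 ≤ C * Real.exp (sawSigmaStar * P.γ)) :
    ∃ ν₀ : ℝ, 0 < ν₀ ∧ ∀ ν ∈ Ioc 0 ν₀, ∀ (j₀ J : ℕ), j₀ ≤ J → ∀ (hz : Bool)
      (w₀ : UnitAddTorus (Fin 2) → EuclideanSpace ℝ (Fin 2))
      (w : ℝ → UnitAddTorus (Fin 2) → EuclideanSpace ℝ (Fin 2)) (q : ℝ → UnitAddTorus (Fin 2) → ℝ),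
      ShearCombDatum (P.N j₀) hz w₀ →
      Torus.IsSmoothSpaceTimeOn (Icc (CascadeParams.tInject j₀ hz) (CascadeParams.tStart (J + 1))) w →
      Torus.IsSmoothSpaceTimeOn (Icc (CascadeParams.tInject j₀ hz) (CascadeParams.tStart (J + 1))) q →
      (∀ t ∈ Icc (CascadeParams.tInject j₀ hz) (CascadeParams.tStart (J + 1)), Torus.IsDivFree (w t)) →
      (∀ t ∈ Icc (CascadeParams.tInject j₀ hz) (CascadeParams.tStart (J + 1)), ∀ x,
        Torus.timeDerivWithin (Icc (CascadeParams.tInject j₀ hz) (CascadeParams.tStart (J + 1))) w t x +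
          Torus.convect (P.field t) (w t) x + Torus.convect (w t) (P.field t) x =
          ν • Torus.laplacian (w t) x - Torus.gradient (q t) x) →
      w (CascadeParams.tInject j₀ hz) = w₀ →
      ∀ t ∈ Icc (CascadeParams.tInject j₀ hz) (CascadeParams.tStart (J + 1)),
        Torus.vectorL2Sq (w t) ≤
          (C * Real.exp (sawSigmaStar * P.γ)) ^ (2 * (J + 1 - j₀)) * Torus.vectorL2Sq w₀ := by
  obtain ⟨ν₀, hν₀, H⟩ := k2PhaseGrowthClassical_apply_of_le h
  refine ⟨ν₀, hν₀, fun ν hν j₀ J hj hz w₀ w q hd hw hq hdiv heq h0 t ht => ?_⟩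
  obtain ⟨J', hj', hJ', ht'⟩ := exists_phase_of_mem_window hj hz ht
  have hE0 : 0 ≤ Torus.vectorL2Sq w₀ := by
    unfold Torus.vectorL2Sq
    exact integral_nonneg fun _ => by positivity
  calc Torus.vectorL2Sq (w t)
      ≤ (C * Real.exp (sawSigmaStar * P.γ)) ^ (2 * (J' + 1 - j₀)) * Torus.vectorL2Sq w₀ :=
      H ν hν j₀ J' J hj' hJ' hz w₀ w q hd hw hq hdiv heq h0 t ht'
    _ ≤ (C * Real.exp (sawSigmaStar * P.γ)) ^ (2 * (J + 1 - j₀)) * Torus.vectorL2Sq w₀ :=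
      mul_le_mul_of_nonneg_right (pow_le_pow_right₀ hC (by omega)) hE0

end Summit.AnomalousDissipation.AnomalousDissipation.Theorems.SawtoothPulseCascade.K2Classical

end
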